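import Summits.KontsevichZagierPeriods.KontsevichZagierPeriods.Theses.FermatIsogeny
import Summits.KontsevichZagierPeriods.KontsevichZagierPeriods.Theorems.FermatIsogenyBetaLinearSectorHalfIntegers

/-!
# `BetaLinearSector` on a TRANSLATION–SWAP CLASS, ALL LEVELS AT ONCE, with NO transcendence input

Crux `BetaLinearSector` (stmt-KontsevichZagierPeriods-3897, route FermatIsogeny): for positive rationals `a b a' b'` and a real algebraic
`c`, two one-dimensional Kontsevich–Zagier representations pinned on `(0,1)` as `[t^{a-1}(1-t)^{b-1}]` and `[c·t^{a'-1}(1-t)^{b'-1}]` with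
the same value are KZ-equivalent.  THIS file proves the crux UNCONDITIONALLY, at every level at once, when `(a', b')` lies in the
`S₂ × ℤ²`-orbit of `(a, b)` — `(a', b') ≡ (a, b)` or `(b, a)` modulo `ℤ²` (registered anchor `betaLinearSector_translationClass`).  On such
an orbit `B(a', b')/B(a, b) ∈ ℚ_{>0}` and the equivalence is a CHAIN OF MOVES: translations (integration by parts inside the rules,
`pinned_translate`) and swaps (`t ↦ 1 − t`, `pinned_swap`), landed in `Theorems/FermatIsogenyBetaLinearSectorHalfIntegers.lean` and
packaged there as the transformers `P_lower_left`, `P_swap_left`, `P_symm` of the two-sided constant-carrying statement `P⟦a, b, a', b'⟧`.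
No transcendence statement is used: inside one orbit two cells with equal values normalise onto the SAME cell with the SAME constant.

* `P_diag` — the diagonal `P⟦a, b, a, b⟧`: two representations pinned with the same exponents and equal values have equal constants
  (`value_of_pinned`, `B(a, b) > 0`), hence congruent integrands on the common domain (rule 1).
* `P_of_class_left` — TARGETED level reduction: `P⟦a, b, a', b'⟧` follows from `P⟦a₀, b₀, a', b'⟧` for all `a₀, b₀` in the base window
  `(0,1]` with `a₀ ≡ a`, `b₀ ≡ b (mod ℤ)` (strong induction on `⌊a⌋ + ⌊b⌋`, exactly as `P_of_base_left_half`; the translation step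
  keeps the classes, the swap step exchanges them).
* `eq_of_window` — a class modulo `ℤ` meets the window `(0,1]` in one point; `P_translationClass` — assembly (reduce left, reduce right
  via `P_symm`, land on `P_diag` or on its swap); `betaLinearSector_translationClass` — the registered form with constant `1` on the left.

References: M. Kontsevich, D. Zagier, *Periods* (2001), §1.2; G. E. Andrews, R. Askey, R. Roy, *Special Functions* (1999), §1.1.
-/

noncomputable section

namespace Summit.KontsevichZagierPeriods.FermatIsogeny.BetaLinearSector.TranslationClass

open MeasureTheory Set
open Literature.NumberTheory.Transcendental
open Literature.NumberTheory.Transcendental.KZ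
open Summit.KontsevichZagierPeriods.FermatIsogeny.BetaLinearSector.HalfIntegers

set_option quotPrecheck false in
/-- `r` is PINNED as `[(0,1), c · t^{a-1}(1-t)^{b-1}]` (the two hypotheses on each representation in the crux, with a constant). -/
local notation "Pinned⟦" c ", " a ", " b ", " r "⟧" =>
  (IntegralRep.domain r = {x : Fin 1 → ℝ | x 0 ∈ Set.Ioo (0:ℝ) 1} ∧
    Set.EqOn (IntegralRep.integrand r) (fun x : Fin 1 → ℝ => (c : ℝ) * (x 0) ^ (((a : ℚ) : ℝ) - 1) * (1 - x 0) ^ (((b : ℚ) : ℝ) - 1))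
      (IntegralRep.domain r))

set_option quotPrecheck false in
/-- The two-sided, constant-carrying form of the crux for fixed exponents: any two representations pinned as `[c·β(a,b)]`,
`[c'·β(a',b')]` (`c, c'` real algebraic) with equal values are KZ-equivalent. -/
local notation "P⟦" a ", " b ", " a' ", " b' "⟧" =>
  (∀ (c c' : ℝ) (r r' : IntegralRep 1), IsAlgebraic ℚ c → IsAlgebraic ℚ c' →
    Pinned⟦c, a, b, r⟧ → Pinned⟦c', a', b', r'⟧ → IntegralRep.value r = IntegralRep.value r' → Equivalent r r')

/-- THE DIAGONAL `P⟦a, b, a, b⟧`: two representations pinned with the SAME exponents and equal values `c·B(a,b) = c'·B(a,b)` have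
equal constants (`B(a,b) = Γ(a)Γ(b)/Γ(a+b) > 0`), hence integrands that agree on the common domain `(0,1)` — a congruence (rule 1).
[cite: KontsevichZagier2001, §1.2 rule (1)] -/
theorem P_diag {a b : ℚ} (ha : 0 < a) (hb : 0 < b) : P⟦a, b, a, b⟧ := by
  intro c c' r r' hc hc' hr hr' hv
  have hB : 0 < Real.Gamma (a:ℝ) * Real.Gamma (b:ℝ) / Real.Gamma ((a:ℝ) + (b:ℝ)) := by
    have haR : (0:ℝ) < a := by exact_mod_cast ha
    have hbR : (0:ℝ) < b := by exact_mod_cast hb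
    exact div_pos (mul_pos (Real.Gamma_pos_of_pos haR) (Real.Gamma_pos_of_pos hbR)) (Real.Gamma_pos_of_pos (by linarith))
  have hcc : c = c' := by
    have h := hv
    rw [value_of_pinned hr ha hb, value_of_pinned hr' ha hb] at h
    exact mul_right_cancel₀ hB.ne' h
  subst hcc
  exact of_sub_of_mem_relations_of_eqOn (by rw [hr.1, hr'.1]) fun x hx => by
    have hx' : x ∈ r'.domain := by rw [hr'.1, ← hr.1]; exact hx
    rw [hr.2 hx, hr'.2 hx']

/-- TARGETED LEVEL REDUCTION on the left pair: if `P⟦a₀, b₀, a', b'⟧` holds for all exponents `a₀, b₀` of the base window `(0,1]` with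
`a₀ ≡ a` and `b₀ ≡ b` modulo `ℤ`, then `P⟦a, b, a', b'⟧` (strong induction on `⌊a⌋ + ⌊b⌋`: the translation `P_lower_left` keeps both
classes, the swap `P_swap_left` exchanges them). [folklore] -/
theorem P_of_class_left {a' b' : ℚ} : ∀ a b : ℚ, 0 < a → 0 < b →
    (∀ a₀ b₀ : ℚ, 0 < a₀ → a₀ ≤ 1 → 0 < b₀ → b₀ ≤ 1 → (∃ i : ℤ, a = a₀ + i) → (∃ j : ℤ, b = b₀ + j) →
      P⟦a₀, b₀, a', b'⟧) → P⟦a, b, a', b'⟧ := by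
  suffices H : ∀ n : ℕ, ∀ a b : ℚ, ⌊a⌋₊ + ⌊b⌋₊ = n → 0 < a → 0 < b →
      (∀ a₀ b₀ : ℚ, 0 < a₀ → a₀ ≤ 1 → 0 < b₀ → b₀ ≤ 1 → (∃ i : ℤ, a = a₀ + i) → (∃ j : ℤ, b = b₀ + j) →
        P⟦a₀, b₀, a', b'⟧) → P⟦a, b, a', b'⟧ from
    fun a b ha hb base => H _ a b rfl ha hb base
  intro n
  induction n using Nat.strong_induction_on with
  | _ n ih =>
    intro a b hn ha hb base
    by_cases hb1 : b ≤ 1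
    · by_cases ha1 : a ≤ 1
      · exact base a b ha ha1 hb hb1 ⟨0, by simp⟩ ⟨0, by simp⟩
      · push Not at ha1
        have ha' : 0 < a - 1 := by linarith
        have hfl : ⌊a⌋₊ = ⌊a - 1⌋₊ + 1 := by
          conv_lhs => rw [← sub_add_cancel a 1]
          exact Nat.floor_add_one ha'.le
        have hlt : ⌊b⌋₊ + ⌊a - 1⌋₊ < n := by omega
        have base' : ∀ a₀ b₀ : ℚ, 0 < a₀ → a₀ ≤ 1 → 0 < b₀ → b₀ ≤ 1 → (∃ i : ℤ, b = a₀ + i) →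
            (∃ j : ℤ, a - 1 = b₀ + j) → P⟦a₀, b₀, a', b'⟧ := by
          rintro a₀ b₀ ha₀ ha₀1 hb₀ hb₀1 hi ⟨j, hj⟩
          exact P_swap_left ha₀ hb₀ (base b₀ a₀ hb₀ hb₀1 ha₀ ha₀1 ⟨j + 1, by push_cast; linarith⟩ hi)
        have hP : P⟦b, (a - 1), a', b'⟧ := ih _ hlt b (a - 1) rfl hb ha' base'
        have hP' : P⟦b, a, a', b'⟧ := by simpa using P_lower_left hb ha' hP
        exact P_swap_left ha hb hP'
    · push Not at hb1
      have hb' : 0 < b - 1 := by linarith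
      have hfl : ⌊b⌋₊ = ⌊b - 1⌋₊ + 1 := by
        conv_lhs => rw [← sub_add_cancel b 1]
        exact Nat.floor_add_one hb'.le
      have hlt : ⌊a⌋₊ + ⌊b - 1⌋₊ < n := by omega
      have base' : ∀ a₀ b₀ : ℚ, 0 < a₀ → a₀ ≤ 1 → 0 < b₀ → b₀ ≤ 1 → (∃ i : ℤ, a = a₀ + i) →
          (∃ j : ℤ, b - 1 = b₀ + j) → P⟦a₀, b₀, a', b'⟧ := by
        rintro a₀ b₀ ha₀ ha₀1 hb₀ hb₀1 hi ⟨j, hj⟩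
        exact base a₀ b₀ ha₀ ha₀1 hb₀ hb₀1 hi ⟨j + 1, by push_cast; linarith⟩
      have hP : P⟦a, (b - 1), a', b'⟧ := ih _ hlt a (b - 1) rfl ha hb' base'
      simpa using P_lower_left ha hb' hP

/-- A class modulo `ℤ` meets the base window `(0,1]` in exactly one point. [folklore] -/
theorem eq_of_window {x y : ℚ} (hx : 0 < x) (hx1 : x ≤ 1) (hy : 0 < y) (hy1 : y ≤ 1) (h : ∃ i : ℤ, x = y + i) :
    x = y := by
  obtain ⟨i, hi⟩ := h
  have h1 : ((i : ℤ) : ℚ) < 1 := by linarith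
  have h2 : (-1 : ℚ) < i := by linarith
  have h1' : i < 1 := by exact_mod_cast h1
  have h2' : -1 < i := by exact_mod_cast h2
  have hi0 : i = 0 := by omega
  rw [hi, hi0, Int.cast_zero, add_zero]

/-- **`P⟦a, b, a', b'⟧` on a translation–swap class**: for `(a', b')` in the `S₂ × ℤ²`-orbit of `(a, b)`, reduce the left pair, then
(via `P_symm`) the right pair, to the base window `(0,1]` inside their classes (`P_of_class_left`); the two reduced pairs are then EQUAL
(`eq_of_window`) — the diagonal `P_diag` — or SWAPPED — `P_swap_left` of the diagonal.  No transcendence input. [cite: KontsevichZagier2001, §1.2] -/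
theorem P_translationClass {a b a' b' : ℚ} (ha : 0 < a) (hb : 0 < b) (ha' : 0 < a') (hb' : 0 < b')
    (h : (∃ i j : ℤ, a' = a + i ∧ b' = b + j) ∨ (∃ i j : ℤ, a' = b + i ∧ b' = a + j)) : P⟦a, b, a', b'⟧ := by
  refine P_of_class_left a b ha hb fun a₀ b₀ ha₀ ha₀1 hb₀ hb₀1 hia hjb => ?_
  refine P_symm (P_of_class_left (a' := a₀) (b' := b₀) a' b' ha' hb' fun a₁ b₁ ha₁ ha₁1 hb₁ hb₁1 hia' hjb' => ?_)
  obtain ⟨i₀, hi₀⟩ := hia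
  obtain ⟨j₀, hj₀⟩ := hjb
  obtain ⟨i₁, hi₁⟩ := hia'
  obtain ⟨j₁, hj₁⟩ := hjb'
  rcases h with ⟨i, j, hai, hbj⟩ | ⟨i, j, hai, hbj⟩
  · -- the same class: the reduced pairs coincide
    have h1 : a₁ = a₀ := eq_of_window ha₁ ha₁1 ha₀ ha₀1 ⟨i₀ + i - i₁, by push_cast; linarith⟩
    have h2 : b₁ = b₀ := eq_of_window hb₁ hb₁1 hb₀ hb₀1 ⟨j₀ + j - j₁, by push_cast; linarith⟩
    rw [h1, h2]
    exact P_diag ha₀ hb₀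
  · -- the swapped class: the reduced pairs are swapped
    have h1 : a₁ = b₀ := eq_of_window ha₁ ha₁1 hb₀ hb₀1 ⟨j₀ + i - i₁, by push_cast; linarith⟩
    have h2 : b₁ = a₀ := eq_of_window hb₁ hb₁1 ha₀ ha₀1 ⟨i₀ + j - j₁, by push_cast; linarith⟩
    rw [h1, h2]
    exact P_swap_left hb₀ ha₀ (P_diag ha₀ hb₀)

/-- **`BetaLinearSector` ON A TRANSLATION–SWAP CLASS — ALL LEVELS AT ONCE, NO TRANSCENDENCE INPUT**: Conjecture 1 of Kontsevich–Zagier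
for every pair of Beta integrals `[∫₀¹ t^{a-1}(1-t)^{b-1}dt]`, `[∫₀¹ c·t^{a'-1}(1-t)^{b'-1}dt]` with positive rational exponents,
`(a', b') ≡ (a, b)` or `(b, a)` modulo `ℤ²`, `c` real algebraic, and equal values — the registered anchor `betaLinearSector_translationClass`
of crux stmt-3897 (its statement restricted to one `S₂ × ℤ²`-orbit; every level at once).  Inputs: the Beta integral and the proved
translation/reflection chains (integration by parts and `t ↦ 1 − t` inside the rules) only. [cite: KontsevichZagier2001, §1.2]
[cite: AndrewsAskeyRoy1999, §1.1] -/
theorem betaLinearSector_translationClass : ∀ (a b a' b' : ℚ) (c : ℝ), 0 < a → 0 < b → 0 < a' → 0 < b' → IsAlgebraic ℚ c →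
    ((∃ i j : ℤ, a' = a + i ∧ b' = b + j) ∨ (∃ i j : ℤ, a' = b + i ∧ b' = a + j)) →
    ∀ (r r' : KZ.IntegralRep 1), r.domain = {x | x 0 ∈ Set.Ioo (0:ℝ) 1} →
    Set.EqOn r.integrand (fun x => (x 0) ^ ((a:ℝ) - 1) * (1 - x 0) ^ ((b:ℝ) - 1)) r.domain →
    r'.domain = {x | x 0 ∈ Set.Ioo (0:ℝ) 1} →
    Set.EqOn r'.integrand (fun x => c * (x 0) ^ ((a':ℝ) - 1) * (1 - x 0) ^ ((b':ℝ) - 1)) r'.domain →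
    r.value = r'.value → KZ.Equivalent r r' := by
  intro a b a' b' c ha hb ha' hb' hc h r r' hd hi hd' hi' hv
  refine P_translationClass ha hb ha' hb' h 1 c r r' isAlgebraic_one hc ⟨hd, fun x hx => ?_⟩ ⟨hd', hi'⟩ hv
  simp only [hi hx, one_mul]

end Summit.KontsevichZagierPeriods.FermatIsogeny.BetaLinearSector.TranslationClass

end
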